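import Summits.ValiantsHypothesis.ValiantsHypothesis.Theorems.BarrierLeverAnchoredDoorHitsLowerPairsStarPivot

/-!
# Route BarrierLever — support item `AnchoredDoorHitsLowerPairs` (stmt-ValiantsHypothesis-22510), line `anchored_peeling`:
# THE PURE-LEAF ROW / COLUMN IDENTITIES of the star-forest entry (val-np-p1 g36)

Helper file (`--supports stmt-ValiantsHypothesis-22510`). Closes NO item; nothing here bears on crux 14610 or on `VP ≠ VNP`, which is NOT proved.

A row vertex `b₀` that is NEVER A CENTRE WITH LEAVES (`d b₀ e = 0` on `S`) is, in every star forest on `insert b₀ A₀ ⊔ S`, either an isolated centre or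
a leaf hanging on exactly one column centre `e ∈ S`. Hence (`starEntry_insert_row_leaf`)

  `starEntry g d (insert b₀ A₀) S = starEntry g d A₀ S + Σ_{e ∈ S} g b₀ e · starEntryColCentre g d A₀ S e`,

where `starEntryColCentre g d A S e` is the sum over the star forests on `A ⊔ S` in which `e` IS A COLUMN CENTRE (`starEntryColCentre`). This is the
algebra of the ORDERED specialisation of …StarOrdered (memo HOME/val-np-p1/g36/MEMO-valnp1-g36.md §2.1): the LAST vertex of the order is such a pure
leaf, so appending it turns the star matrix `K` of the remaining vertices into `[K ; K + ∂_c K]` (rows `A ∌ b₀` ; rows `A ∋ b₀ ↔ A ∖ b₀`) with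
`(∂_c K)[A,S] = Σ_{e ∈ S} c_e · starEntryColCentre g d A S e`, `c = g b₀ ·` the fresh leaf weights; on a lower row family the `K` part of the new rows
is removed by row operations, which is why lower minors of ordered kernels obey `det K_N[I,J] = det [K_{N−1}[del_{b₀} I, J] ; ∂_c K_{N−1}[lk_{b₀} I, J]]`.
The transposed identity `starEntry_insert_col_leaf` (a column vertex that is never a centre with leaves) is derived through `starEntry_swap`.
-/

set_option linter.dupNamespace false

namespace Summit.ValiantsHypothesis.ValiantsHypothesis.Theorems.BarrierLever.AnchoredPeeling

open Finset

noncomputable section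

namespace StarDoor

variable {K : Type*} [CommRing K] {h : ℕ}

/-- **Star forests with a prescribed column centre.** `starEntryColCentre g d A S e` = the part of `starEntry g d A S` coming from the star forests in
which the column vertex `e` is a CENTRE (`e ∈ S'`): `Σ_{A' ⊆ A} Σ_{S' ⊆ S, e ∈ S'} (∏_{b ∈ A ∖ A'} Σ_{e' ∈ S'} g b e') · ∏_{e' ∈ S ∖ S'} Σ_{b ∈ A'} d b e'`.
It vanishes unless `e ∈ S`. -/
def starEntryColCentre (g d : Fin h → Fin h → K) (A S : Finset (Fin h)) (e : Fin h) : K :=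
  ∑ A' ∈ A.powerset, ∑ S' ∈ S.powerset with e ∈ S', (∏ b ∈ A \ A', ∑ e' ∈ S', g b e') * (∏ e' ∈ S \ S', ∑ b ∈ A', d b e')

/-- **Star forests with a prescribed row centre** (the transposed notion): the part of `starEntry g d A S` in which the row vertex `b` is a CENTRE. -/
def starEntryRowCentre (g d : Fin h → Fin h → K) (A S : Finset (Fin h)) (b : Fin h) : K :=
  ∑ A' ∈ A.powerset with b ∈ A', ∑ S' ∈ S.powerset, (∏ b' ∈ A \ A', ∑ e ∈ S', g b' e) * (∏ e ∈ S \ S', ∑ b' ∈ A', d b' e)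

/-- `starEntryColCentre g d A S e = 0` when `e ∉ S`. -/
theorem starEntryColCentre_eq_zero_of_notMem (g d : Fin h → Fin h → K) {A S : Finset (Fin h)} {e : Fin h} (he : e ∉ S) :
    starEntryColCentre g d A S e = 0 := by
  unfold starEntryColCentre
  refine Finset.sum_eq_zero fun A' _ => Finset.sum_eq_zero fun S' hS' => ?_
  exfalso
  rw [Finset.mem_filter, Finset.mem_powerset] at hS'
  exact he (hS'.1 hS'.2)

/-- The two centre notions are exchanged by the row/column swap (cf. `starEntry_swap`). -/
theorem starEntryRowCentre_swap (g d : Fin h → Fin h → K) (A S : Finset (Fin h)) (b : Fin h) :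
    starEntryRowCentre g d A S b = starEntryColCentre (fun e b' => d b' e) (fun e b' => g b' e) S A b := by
  unfold starEntryRowCentre starEntryColCentre
  rw [Finset.sum_comm]
  refine Finset.sum_congr rfl fun S' _ => Finset.sum_congr rfl fun A' _ => ?_
  rw [mul_comm]

/-- **PURE-LEAF ROW IDENTITY.** If `b₀ ∉ A₀` is never a centre with leaves on `S` (`d b₀ e = 0` for `e ∈ S`), then
`starEntry g d (insert b₀ A₀) S = starEntry g d A₀ S + Σ_{e ∈ S} g b₀ e · starEntryColCentre g d A₀ S e`
(`b₀` is an isolated centre, or a leaf of the column centre `e`). -/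
theorem starEntry_insert_row_leaf (g d : Fin h → Fin h → K) {A₀ S : Finset (Fin h)} {b₀ : Fin h} (hb₀ : b₀ ∉ A₀)
    (hd : ∀ e ∈ S, d b₀ e = 0) :
    starEntry g d (insert b₀ A₀) S = starEntry g d A₀ S + ∑ e ∈ S, g b₀ e * starEntryColCentre g d A₀ S e := by
  classical
  unfold starEntry
  rw [Finset.sum_powerset_insert hb₀, add_comm]
  congr 1
  · -- `b₀` a centre: its leaf set is empty since `d b₀ · = 0` on `S`
    refine Finset.sum_congr rfl fun T hT => Finset.sum_congr rfl fun S' hS' => ?_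
    have hTA : T ⊆ A₀ := Finset.mem_powerset.mp hT
    have hS'S : S' ⊆ S := Finset.mem_powerset.mp hS'
    have hb₀T : b₀ ∉ T := fun hbT => hb₀ (hTA hbT)
    have hsd : insert b₀ A₀ \ insert b₀ T = A₀ \ T := by
      rw [Finset.insert_sdiff_insert, Finset.sdiff_insert_of_notMem hb₀]
    rw [hsd]
    congr 1
    refine Finset.prod_congr rfl fun e he => ?_
    rw [Finset.sum_insert hb₀T, hd e (Finset.mem_sdiff.mp he).1, zero_add]
  · -- `b₀` a leaf: it hangs on one column centre `e ∈ S'`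
    have hrow : ∀ T ∈ A₀.powerset, ∀ S' ∈ S.powerset,
        (∏ b ∈ insert b₀ A₀ \ T, ∑ e ∈ S', g b e) * (∏ e ∈ S \ S', ∑ b ∈ T, d b e)
          = ∑ e ∈ S, if e ∈ S' then g b₀ e * ((∏ b ∈ A₀ \ T, ∑ e' ∈ S', g b e') * ∏ e' ∈ S \ S', ∑ b ∈ T, d b e') else 0 := by
      intro T hT S' hS'
      have hTA : T ⊆ A₀ := Finset.mem_powerset.mp hT
      have hS'S : S' ⊆ S := Finset.mem_powerset.mp hS'
      have hb₀T : b₀ ∉ T := fun hbT => hb₀ (hTA hbT)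
      have hsd : insert b₀ A₀ \ T = insert b₀ (A₀ \ T) := Finset.insert_sdiff_of_notMem A₀ hb₀T
      have hnot : b₀ ∉ A₀ \ T := fun hb => hb₀ (Finset.mem_sdiff.mp hb).1
      rw [hsd, Finset.prod_insert hnot, ← Finset.sum_filter, mul_assoc, Finset.sum_mul]
      have hfil : S.filter (fun e => e ∈ S') = S' := by
        ext e
        rw [Finset.mem_filter]
        exact ⟨fun h => h.2, fun h => ⟨hS'S h, h⟩⟩
      rw [hfil]
    rw [Finset.sum_congr rfl fun T hT => Finset.sum_congr rfl fun S' hS' => hrow T hT S' hS']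
    -- exchange the order of summation
    simp_rw [Finset.sum_comm (s := S.powerset) (t := S)]
    rw [Finset.sum_comm]
    refine Finset.sum_congr rfl fun e _ => ?_
    unfold starEntryColCentre
    rw [Finset.mul_sum]
    refine Finset.sum_congr rfl fun T _ => ?_
    rw [Finset.sum_filter, Finset.mul_sum]
    refine Finset.sum_congr rfl fun S' _ => ?_
    by_cases he : e ∈ S' <;> simp [he]

/-- **PURE-LEAF COLUMN IDENTITY** (transpose of `starEntry_insert_row_leaf`). If `e₀ ∉ S₀` is never a centre with leaves on `A`
(`g b e₀ = 0` for `b ∈ A`), then `starEntry g d A (insert e₀ S₀) = starEntry g d A S₀ + Σ_{b ∈ A} d b e₀ · starEntryRowCentre g d A S₀ b`. -/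
theorem starEntry_insert_col_leaf (g d : Fin h → Fin h → K) {A S₀ : Finset (Fin h)} {e₀ : Fin h} (he₀ : e₀ ∉ S₀)
    (hg : ∀ b ∈ A, g b e₀ = 0) :
    starEntry g d A (insert e₀ S₀) = starEntry g d A S₀ + ∑ b ∈ A, d b e₀ * starEntryRowCentre g d A S₀ b := by
  rw [starEntry_swap, starEntry_insert_row_leaf (K := K) (fun e b => d b e) (fun e b => g b e) he₀ hg, ← starEntry_swap]
  congr 1
  refine Finset.sum_congr rfl fun b _ => ?_
  rw [starEntryRowCentre_swap]

/-- The column-centre parts add up to the whole entry weighted by the number of column centres — in particular every star forest on `A ⊔ S` with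
`A` nonempty... (sanity identity): `Σ_{e ∈ S} starEntryColCentre g d A S e = Σ_{A' ⊆ A} Σ_{S' ⊆ S} |S'| · (summand)`. -/
theorem sum_starEntryColCentre (g d : Fin h → Fin h → K) (A S : Finset (Fin h)) :
    ∑ e ∈ S, starEntryColCentre g d A S e
      = ∑ A' ∈ A.powerset, ∑ S' ∈ S.powerset, (S'.card : K) * ((∏ b ∈ A \ A', ∑ e' ∈ S', g b e') * ∏ e' ∈ S \ S', ∑ b ∈ A', d b e') := by
  classical
  unfold starEntryColCentre
  rw [Finset.sum_comm]
  refine Finset.sum_congr rfl fun A' _ => ?_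
  simp_rw [Finset.sum_filter]
  rw [Finset.sum_comm]
  refine Finset.sum_congr rfl fun S' hS' => ?_
  have hS'S : S' ⊆ S := Finset.mem_powerset.mp hS'
  rw [← Finset.sum_filter]
  have hfil : S.filter (fun e => e ∈ S') = S' := by
    ext e
    rw [Finset.mem_filter]
    exact ⟨fun h => h.2, fun h => ⟨hS'S h, h⟩⟩
  rw [hfil, Finset.sum_const, nsmul_eq_mul]

/-! ## The pure-leaf REDUCTION PRINCIPLE (determinant form) -/

section Reduction

variable {r : ℕ} (u w : Fin r → Finset (Fin h)) (b₀ : Fin h)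

/-- **PURE-LEAF REDUCTION PRINCIPLE.** Let `u` be a LOWER row family, `w` any column family, and let the row vertex `b₀` never be a centre with
leaves (`d b₀ e = 0` for all `e`; e.g. `b₀` is the LAST vertex of an order, …StarOrdered). Replace every row `i` through `b₀` of the star-forest block
by the «derivative row» `j ↦ Σ_{e ∈ w j} g b₀ e · starEntryColCentre g d ((u i) ∖ b₀) (w j) e` (the forests in which `b₀` is a leaf, read on the
column centre it hangs on) and keep the other rows. If the REDUCED block is nonsingular, so is the star-forest block. (Row operations: by
`starEntry_insert_row_leaf`, row `i` minus its partner row `(u i) ∖ b₀ ∈ range u` is the derivative row; `det (reduced) = det (1 − P) · det (star block)`.)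
This is the algebra of appending a pure leaf to an ordered kernel: `K_N = [K_{N−1} ; K_{N−1} + ∂_c K_{N−1}]`. -/
theorem starDet_ne_zero_of_leafReduction (hlu : IsLowerSet (Set.range u)) (g d : Fin h → Fin h → K) (hd : ∀ e, d b₀ e = 0)
    (hR : (Matrix.of fun i j : Fin r =>
      if b₀ ∈ u i then ∑ e ∈ w j, g b₀ e * starEntryColCentre g d ((u i).erase b₀) (w j) e else starEntry g d (u i) (w j)).det ≠ 0) :
    (Matrix.of fun i j : Fin r => starEntry g d (u i) (w j)).det ≠ 0 := by
  classical
  -- partners `u (p i) = (u i).erase b₀`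
  have hrow : ∀ i, ∃ i' : Fin r, u i' = (u i).erase b₀ := exists_partner u b₀ hlu
  choose p hp using hrow
  let M : Matrix (Fin r) (Fin r) K := Matrix.of fun i j : Fin r => starEntry g d (u i) (w j)
  let P : Matrix (Fin r) (Fin r) K := Matrix.of fun i i' => if b₀ ∈ u i ∧ i' = p i then 1 else 0
  have hPM : ∀ i j, (P * M) i j = if b₀ ∈ u i then M (p i) j else 0 := by
    intro i j
    rw [Matrix.mul_apply]
    by_cases hb : b₀ ∈ u i
    · rw [if_pos hb, Finset.sum_eq_single (p i)]
      · simp [P, hb]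
      · intro i' _ hi'; simp [P, hi']
      · intro h'; exact (h' (Finset.mem_univ _)).elim
    · rw [if_neg hb]
      exact Finset.sum_eq_zero fun i' _ => by simp [P, hb]
  -- the reduced matrix is `(1 - P) * M`
  have hred : ((1 - P) * M) = Matrix.of fun i j : Fin r =>
      if b₀ ∈ u i then ∑ e ∈ w j, g b₀ e * starEntryColCentre g d ((u i).erase b₀) (w j) e else starEntry g d (u i) (w j) := by
    ext i j
    rw [Matrix.sub_mul, Matrix.one_mul, Matrix.sub_apply, hPM i j, Matrix.of_apply]
    by_cases hb : b₀ ∈ u i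
    · rw [if_pos hb, if_pos hb]
      simp only [M, Matrix.of_apply]
      rw [hp i]
      have key : starEntry g d (u i) (w j) = starEntry g d ((u i).erase b₀) (w j)
          + ∑ e ∈ w j, g b₀ e * starEntryColCentre g d ((u i).erase b₀) (w j) e := by
        conv_lhs => rw [← Finset.insert_erase hb]
        exact starEntry_insert_row_leaf g d (Finset.notMem_erase b₀ (u i)) (fun e _ => hd e)
      rw [key]
      ring
    · rw [if_neg hb, if_neg hb, sub_zero]
      simp only [M, Matrix.of_apply]
  intro hM0
  apply hR
  rw [← hred, Matrix.det_mul]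
  have : M.det = 0 := hM0
  rw [this, mul_zero]

/-- **Transposed reduction principle** (a column vertex `e₀` that is never a centre with leaves, `w` lower): replace every column through `e₀` by
`i ↦ Σ_{b ∈ u i} d b e₀ · starEntryRowCentre g d (u i) ((w j) ∖ e₀) b`. -/
theorem starDet_ne_zero_of_leafReduction_col (hlw : IsLowerSet (Set.range w)) (g d : Fin h → Fin h → K) (e₀ : Fin h)
    (hg : ∀ b, g b e₀ = 0)
    (hR : (Matrix.of fun i j : Fin r =>
      if e₀ ∈ w j then ∑ b ∈ u i, d b e₀ * starEntryRowCentre g d (u i) ((w j).erase e₀) b else starEntry g d (u i) (w j)).det ≠ 0) :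
    (Matrix.of fun i j : Fin r => starEntry g d (u i) (w j)).det ≠ 0 := by
  classical
  -- transpose: rows ↔ columns, `g ↔ dᵀ`
  have hT := starDet_ne_zero_of_leafReduction (K := K) w u e₀ hlw (fun e b => d b e) (fun e b => g b e) hg ?_
  · intro h0
    apply hT
    rw [← Matrix.det_transpose]
    convert h0 using 2
    ext i j
    simp only [Matrix.transpose_apply, Matrix.of_apply]
    rw [← starEntry_swap]
  · intro h0
    apply hR
    rw [← Matrix.det_transpose]
    convert h0 using 2
    ext i j
    simp only [Matrix.transpose_apply, Matrix.of_apply]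
    by_cases he : e₀ ∈ w i
    · rw [if_pos he, if_pos he]
      refine Finset.sum_congr rfl fun b _ => ?_
      rw [starEntryRowCentre_swap]
    · rw [if_neg he, if_neg he, ← starEntry_swap]

end Reduction

end StarDoor

end

end Summit.ValiantsHypothesis.ValiantsHypothesis.Theorems.BarrierLever.AnchoredPeeling
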